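import Literature.AlgebraicGeometry.HodgeTheory.WeilClassesFieldIntersections
import Literature.AlgebraicGeometry.HodgeTheory.WeilClassesFieldFLinear
import Literature.AlgebraicGeometry.Milne1999.CentraliserFixesDivisorClasses
import Literature.AlgebraicGeometry.Milne1999.SpecialLefschetzGroupInvariantsHodgeClasses
import Literature.AlgebraicGeometry.Milne1999.SpecialLefschetzGroupInvariantsProducts
import HarnessLib

/-!
# Weil classes and the Lefschetz group: `W_F` decomposable ⟹ `S(A) ⊂ SL_F(H¹)`; an element of `S(A)(ℂ)` with
# `det(u | V_ρ) ≠ 1` makes every non-zero Weil class of `F` exceptional (Moonen–Zarhin 1998, proof of Criterion (2),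
# the mechanism, on the carriers)

Layer `Literature/AlgebraicGeometry/HodgeTheory`, theorem-only junction of the seat's `WeilClassesFieldAllOrNothing` /
`WeilClassesFieldIntersections` (the dichotomy `W_F ⊗ ℂ ⊓ Dᵐ ⊗ ℂ = ⊥` or `W_F ⊗ ℂ ≤ Dᵐ ⊗ ℂ`) and `WeilClassesFieldFLinear`
(Moonen–Zarhin's Lemma (2) for an arbitrary multiplicative pair) with the tree's Milne 1999 layer: `S(A)(ℂ) =
Milne1999.unitaryCentralizerGroup A h` (the automorphisms of `H¹(A(ℂ); ℂ)` commuting with `End(A)` and preserving the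
polarization pairing `Q_h`; Milne's `S(A) = ker l(A)`, Moonen–Zarhin's `G_div(X) = Gl_B(V) ∩ Sp(V, φ)` for `B = End⁰(X)`),
its exterior action `⋀^{2p}u = exteriorPullback _ u (2p)` on `H^{2p}(A(ℂ); ℂ) = ⋀^{2p}H¹`, Milne's Thm. 4.4 «any
`γ ∈ G(A)` will fix all divisor classes» (`Milne1999.exteriorPullback_eq_self_of_mem_divisorClassesSpan`) and «the
`S(A)`-invariants are Hodge classes» (`Milne1999.mem_hodgeClassSpan_of_forall_exteriorPullback_eq`, through `Hg ≤ S` and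
Deligne I 3.4).  Everything is proved; no definition, no named fact.

PRINTED STATEMENT.  B. J. J. Moonen – Yu. G. Zarhin, *Weil classes on abelian varieties*, J. reine angew. Math. 496
(1998) 83–92 = arXiv:alg-geom/9612017 (held text `paper:arxiv-alg-geom_9612017`).  §1 (chunk p0002, lines 60–66):
«the main motivation for introducing this group `G_div(X)` is the fact that it is the largest algebraic subgroup of
`Gl(V)` defined over `ℚ` which leaves invariant all divisor classes in `H²(X,ℚ) = ⋀²V`»; Lemma (3) (chunk p0003, lines
4–5): «`End(V_X)^{G_div(X)} = B`; `(⋀²V_X)^{G_div(X)} = B¹(X)`, and `(⊕_i ⋀^i V_X)^{G_div(X)} = D^•(X)`»; Lemma (2) (ibid.):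
«If `g ∈ Gl_ℚ(V)` acts as the identity on `W_F` then `g` is `F`-linear, hence `g ∈ Sl_F(V)`»; Criterion (chunk p0003,
lines 47–62): «Then either all classes in `W_F` are decomposable, or all non-zero classes in `W_F` are exceptional …
Proof. … We claim that, in these cases, `G_div(X)` acts as the identity on `W_F` if and only if `F ⊆ B`.  In the “only
if” direction, this follows from Lemmas (2) and (3).  Conversely … `G_div(X) ⊆ Sl_F(V_X)`, hence `G_div(X)` acts trivially
on `W_F`»; and the type 3 computation (chunk p0003/p0004): «an element `g ∈ G_div^{(τ)}(ℂ)` which is not in the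
connected component … acts on `W_F ⊗ ℂ` as multiplication by `(−1)^{2m/[F:E]}`, which proves the assertion» (odd exponent
⟹ all non-zero classes of `W_F` exceptional).

RENDERING.  In the tree `F = ℚ(φ) ⊆ End⁰(A)` always, so «`G_div` acts on `W_F` through `det_F`» is available for every
`u ∈ S(A)(ℂ)` (they commute with `φ^*`).  The two printed mechanisms become: (a) `W_F ⊗ ℂ ≤ Dᵐ ⊗ ℂ` ⟹ every `⋀^{2m}u`,
`u ∈ S(A)(ℂ)`, is the identity on `W_F ⊗ ℂ` (Milne 4.4 / Lemma (3) «`D^• = invariants`», the inclusion `D^• ⊆ invariants`)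
⟹ `det(u | V_ρ) = 1` at every root (Lemma (2)); (b) contrapositively, ONE `u ∈ S(A)(ℂ)` with `det(u | V_ρ) ≠ 1` at ONE
root forces `W_F ⊗ ℂ ⊓ Dᵐ ⊗ ℂ = ⊥` — «all non-zero classes in `W_F` are exceptional» — by the all-or-nothing dichotomy.
The reverse inclusion «invariants `⊆ D^•`» (Lemma (3), Milne Thm. 3.2) is in the tree only as «invariants `⊆ B ⊗ ℂ`»
(and `⊆ D ⊗ ℂ` on the `B = D` locus), which gives (c): `S(A)(ℂ) ⊂ Sl_F` ⟹ `W_F ⊗ ℂ ≤ Bᵐ ⊗ ℂ` (Hodge).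

WHAT IS PROVED.  `P ∈ ℤ[T]` monic irreducible of degree `e`, `P(φ) = 0`, `e · 2m = 2 dim A`; `h ∈ H²(A(ℂ); ℂ)` rational
with a Kähler multiple (a polarization class — one exists, `Milne1999.exists_polarizationClass`); `u ∈ S(A)(ℂ) =
unitaryCentralizerGroup A h`.
* §1 **`exteriorPullback_apply_eq_of_mem_weilClassesField_of_le_divisorClassesSpan`** — `W_F ⊗ ℂ ≤ Dᵐ ⊗ ℂ` ⟹
  `⋀^{2m}u = id` on `W_F ⊗ ℂ`; **`detOnEigenspace_eq_one_of_mem_unitaryCentralizerGroup_of_le_divisorClassesSpan`** — ⟹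
  `det(u | V_ρ) = 1` at every complex root `ρ` of `P` («only if … from Lemmas (2) and (3)»: `S(A)(ℂ) ⊂ Sl_F(V)(ℂ)`).
* §2 THE EXCEPTIONALITY CRITERION: **`weilClassesField_inf_divisorClassesSpan_eq_bot_of_detOnEigenspace_ne_one`** — if
  some `u ∈ S(A)(ℂ)` has `det(u | V_ρ) ≠ 1` at some root (`m ≠ 0`), then `W_F ⊗ ℂ ⊓ Dᵐ ⊗ ℂ = ⊥`, and
  (`forall_not_mem_divisorClassesSpan_of_detOnEigenspace_ne_one`) every non-zero RATIONAL Weil class is exceptional;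
  `natDegree_le_finrank_sub_of_detOnEigenspace_ne_one_of_balanced` — if moreover `n_ρ = n_ρ̄` at every root (`W_F`
  Hodge) then `[F:ℚ] ≤ dim_ℂ Bᵐ ⊗ ℂ − dim_ℂ Dᵐ ⊗ ℂ`.
* §3 «`G_div(X) ⊆ Sl_F(V_X)`, hence acts trivially on `W_F`» ⟹ HODGE: **`weilClassesField_le_hodgeClassSpan_of_forall_
  unitaryCentralizerGroup_detOnEigenspace_eq_one`** — if `det(u | V_ρ) = 1` for all `u ∈ S(A)(ℂ)` and all roots, then
  `W_F ⊗ ℂ ≤ Bᵐ ⊗ ℂ` (Lemma (2) converse + `S`-invariants are Hodge), hence `n_ρ = n_ρ̄` at every root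
  (`forall_eigenMultiplicity_eq_of_forall_unitaryCentralizerGroup_detOnEigenspace_eq_one`); on the `B = D` locus
  (`IsDivisorGenerated A`) even `W_F ⊗ ℂ ≤ Dᵐ ⊗ ℂ` (`weilClassesField_le_divisorClassesSpan_of_forall_
  detOnEigenspace_eq_one_of_isDivisorGenerated`).

Honesty clause: (b) is a CRITERION — nothing here exhibits such a `u` for any particular `A`; no Weil class is proved
exceptional, Hodge or algebraic outright; Lemma (3)'s «invariants `⊆ D^•`» is NOT proved here.
No `sorry`; axioms `propext`, `Classical.choice`, `Quot.sound`.

## References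
* [MoonenZarhin1998WeilClasses] B. J. J. Moonen, Yu. G. Zarhin, *Weil classes on abelian varieties*, J. reine angew.
  Math. 496 (1998) 83–92 = arXiv:alg-geom/9612017, §1: `G_div(X)` (chunk p0002), Lemma (2)–(3), Criterion (2) and its
  proof (chunks p0003–p0004).
* [Milne1999LefschetzClasses] J. S. Milne, *Lefschetz classes on abelian varieties*, Duke Math. J. 96 (1999) 639–675, §1
  p. 644 (`S(A)`), Thm. 3.2, Thm. 4.4 (p. 659), p. 660 (`L(A) ⊃ Hg(A)`).
* [Deligne1982HodgeCycles] P. Deligne (notes by J. S. Milne), LNM 900 (1982), I §3 Prop. 3.4.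
* [vanGeemen1994HodgeAV] B. van Geemen, LNM 1594 (1994), 2.4–2.5 (exceptional classes), 6.5–6.7.
-/

noncomputable section

open CategoryTheory Polynomial Module

namespace Literature.AlgebraicGeometry.HodgeTheory

open Literature.AlgebraicGeometry.Motives (AbelianVariety IsSmoothProjective ComplexPoints)
open Literature.AlgebraicGeometry.VanGeemen1994 (hodgeClassSpan pullbackOne detOnEigenspace)
open Literature.AlgebraicGeometry.Milne1999 (unitaryCentralizerGroup exteriorPullback_eq_self_of_mem_divisorClassesSpan
  mem_hodgeClassSpan_of_forall_exteriorPullback_eq)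
open Literature.AlgebraicTopology.SingularHomology
open Literature.Barriers.HodgeConjecture (divisorClassesSpan)

section HodgeTheory

variable {A : AbelianVariety ℂ} {φ : A ⟶ A} {P : Polynomial ℤ} {e m : ℕ} {h : complexBetti A.X 2}
  {u : complexBetti A.X 1 ≃ₗ[ℂ] complexBetti A.X 1}

/-- The exterior action `⋀ʳu` of an automorphism of `H¹` is a multiplicative pair with `u` in the sense of
`WeilClassesFieldFLinear` (`⋀ʳu (v₁ ∪ ⋯ ∪ v_r) = u v₁ ∪ ⋯ ∪ u v_r`, the tree's `exteriorPullback_cupPowOne`).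
[cite: HatcherAT2002, §3.2 Example 3.16] -/
theorem exteriorPullback_cupPowOne_abelianVariety (u : complexBetti A.X 1 ≃ₗ[ℂ] complexBetti A.X 1) (r : ℕ)
    (v : Fin r → complexBetti A.X 1) :
    exteriorPullback (Motives.AbelianVariety.hasExteriorCohomologyH1_complexPoints A)
        (u : complexBetti A.X 1 →ₗ[ℂ] complexBetti A.X 1) r (cupPowOne ℂ (ComplexPoints A.X) r v) =
      cupPowOne ℂ (ComplexPoints A.X) r (fun i => u (v i)) :=
  exteriorPullback_cupPowOne _ _ r v

/-! ### §1 `W_F` decomposable ⟹ `S(A)(ℂ)` acts trivially on `W_F ⊗ ℂ` ⟹ `S(A)(ℂ) ⊂ Sl_F(V)(ℂ)` -/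

section Decomposable

/-- **`W_F ⊗ ℂ ≤ Dᵐ ⊗ ℂ` ⟹ `G_div` acts trivially on `W_F ⊗ ℂ`**: for a polarization class `h` (rational, with a Kähler
multiple) and `u ∈ S(A)(ℂ) = unitaryCentralizerGroup A h`, `⋀^{2m}u` fixes every class of `weilClassesField A φ P (2m)`
as soon as the latter lies in the complexified divisor ring («`G_div(X)` … leaves invariant all divisor classes», Milne
Thm. 4.4 on the carriers). [cite: MoonenZarhin1998WeilClasses, §1 (G_div, chunk p0002 lines 60–66; Lemma (3))]
[cite: Milne1999LefschetzClasses, Thm. 4.4 (p. 659)] -/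
theorem exteriorPullback_apply_eq_of_mem_weilClassesField_of_le_divisorClassesSpan (hQ : IsRationalClass h)
    (hK : ∃ s : ℝ, 0 < s ∧ IsKaehlerClass A.dim A.X ((s : ℂ) • h)) (hu : u ∈ unitaryCentralizerGroup A h)
    (hW : weilClassesField A φ P (2 * m) ≤ divisorClassesSpan A.X A.dim m) {c : complexBetti A.X (2 * m)}
    (hc : c ∈ weilClassesField A φ P (2 * m)) :
    exteriorPullback (Motives.AbelianVariety.hasExteriorCohomologyH1_complexPoints A)
      (u : complexBetti A.X 1 →ₗ[ℂ] complexBetti A.X 1) (2 * m) c = c :=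
  exteriorPullback_eq_self_of_mem_divisorClassesSpan hQ hK hu m (hW hc)

/-- **«In the “only if” direction, this follows from Lemmas (2) and (3)»: `W_F` decomposable ⟹ `S(A)(ℂ) ⊂ Sl_F(V)(ℂ)`.**
For `P ∈ ℤ[T]` monic irreducible of degree `e`, `P(φ) = 0`, `e · 2m = 2 dim A`, a polarization class `h` and
`u ∈ S(A)(ℂ)`: if `W_F ⊗ ℂ ≤ Dᵐ ⊗ ℂ` then `det(u | V_ρ) = 1` at every complex root `ρ` of `P` (§1 and Moonen–Zarhin's
Lemma (2) on the carriers, `apply_eq_detOnEigenspace_smul_of_comm`). [cite: MoonenZarhin1998WeilClasses, §1 Lemma (2)–(3)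
and proof of Criterion (2) (chunk p0003)] [cite: Milne1999LefschetzClasses, Thm. 4.4] -/
theorem detOnEigenspace_eq_one_of_mem_unitaryCentralizerGroup_of_le_divisorClassesSpan (hPm : P.Monic)
    (hPe : P.natDegree = e) (hPirr : Irreducible (P.map (Int.castRingHom ℚ)))
    (hφ : Polynomial.eval₂ (Int.castRingHom (CategoryTheory.End A)) (φ : CategoryTheory.End A) P = 0)
    (her : e * (2 * m) = 2 * A.dim) (hQ : IsRationalClass h) (hK : ∃ s : ℝ, 0 < s ∧ IsKaehlerClass A.dim A.X ((s : ℂ) • h))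
    (hu : u ∈ unitaryCentralizerGroup A h) (hW : weilClassesField A φ P (2 * m) ≤ divisorClassesSpan A.X A.dim m)
    {ρ : ℂ} (hρ : Polynomial.eval₂ (Int.castRingHom ℂ) ρ P = 0) :
    detOnEigenspace u (pullbackOne A φ) (hu.1 φ) ρ = 1 := by
  obtain ⟨ω, hω, hω0, -, -⟩ := exists_generator_pullbackEigenclasses_of_root hPm hPe hPirr hφ her hρ
  have hdet := apply_eq_detOnEigenspace_smul_of_comm hPm hPe hPirr hφ her (exteriorPullback_cupPowOne_abelianVariety u _)
    (hu.1 φ) hρ hω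
  rw [exteriorPullback_apply_eq_of_mem_weilClassesField_of_le_divisorClassesSpan hQ hK hu hW
    (pullbackEigenclasses_le_weilClassesField hρ hω)] at hdet
  exact (smul_left_injective ℂ hω0 ((one_smul ℂ ω).trans hdet)).symm

end Decomposable

/-! ### §2 The exceptionality criterion: one `u ∈ S(A)(ℂ)` with `det(u | V_ρ) ≠ 1` -/

section Exceptional

/-- **ONE ELEMENT OF `S(A)(ℂ)` OUTSIDE `Sl_F` MAKES THE WEIL CLASSES OF `F` EXCEPTIONAL**: for `P ∈ ℤ[T]` monic irreducible
of degree `e`, `P(φ) = 0`, `e · 2m = 2 dim A`, `m ≠ 0`, a polarization class `h` and `u ∈ S(A)(ℂ) = unitaryCentralizerGroup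
A h` with `det(u | V_ρ) ≠ 1` at some complex root `ρ` of `P`: `W_F ⊗ ℂ ⊓ Dᵐ ⊗ ℂ = ⊥` (§1 forbids `W_F ⊗ ℂ ≤ Dᵐ ⊗ ℂ`;
all-or-nothing, `weilClassesField_inf_divisorClassesSpan_eq_bot_or_le`).  This is the mechanism of Moonen–Zarhin's
type 3 computation («`g` … acts on `W_F ⊗ ℂ` as multiplication by `(−1)^{2m/[F:E]}`»).
[cite: MoonenZarhin1998WeilClasses, §1 Criterion (2) and its proof (chunks p0003–p0004)] -/
theorem weilClassesField_inf_divisorClassesSpan_eq_bot_of_detOnEigenspace_ne_one (hPm : P.Monic)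
    (hPe : P.natDegree = e) (hPirr : Irreducible (P.map (Int.castRingHom ℚ)))
    (hφ : Polynomial.eval₂ (Int.castRingHom (CategoryTheory.End A)) (φ : CategoryTheory.End A) P = 0)
    (her : e * (2 * m) = 2 * A.dim) (hm : m ≠ 0) (hQ : IsRationalClass h)
    (hK : ∃ s : ℝ, 0 < s ∧ IsKaehlerClass A.dim A.X ((s : ℂ) • h)) (hu : u ∈ unitaryCentralizerGroup A h)
    {ρ : ℂ} (hρ : Polynomial.eval₂ (Int.castRingHom ℂ) ρ P = 0)
    (hdet : detOnEigenspace u (pullbackOne A φ) (hu.1 φ) ρ ≠ 1) :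
    weilClassesField A φ P (2 * m) ⊓ divisorClassesSpan A.X A.dim m = ⊥ := by
  rcases weilClassesField_inf_divisorClassesSpan_eq_bot_or_le hPe hPirr hφ her hm with hbot | hle
  · exact hbot
  · exact absurd (detOnEigenspace_eq_one_of_mem_unitaryCentralizerGroup_of_le_divisorClassesSpan hPm hPe hPirr hφ her
      hQ hK hu hle hρ) hdet

/-- … hence **every non-zero rational Weil class of `F` is exceptional** (outside `Dᵐ ⊗ ℂ`).
[cite: MoonenZarhin1998WeilClasses, §1 Criterion (2) («all non-zero classes in W_F are exceptional»)] -/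
theorem forall_not_mem_divisorClassesSpan_of_detOnEigenspace_ne_one (hPm : P.Monic) (hPe : P.natDegree = e)
    (hPirr : Irreducible (P.map (Int.castRingHom ℚ)))
    (hφ : Polynomial.eval₂ (Int.castRingHom (CategoryTheory.End A)) (φ : CategoryTheory.End A) P = 0)
    (her : e * (2 * m) = 2 * A.dim) (hm : m ≠ 0) (hQ : IsRationalClass h)
    (hK : ∃ s : ℝ, 0 < s ∧ IsKaehlerClass A.dim A.X ((s : ℂ) • h)) (hu : u ∈ unitaryCentralizerGroup A h)
    {ρ : ℂ} (hρ : Polynomial.eval₂ (Int.castRingHom ℂ) ρ P = 0)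
    (hdet : detOnEigenspace u (pullbackOne A φ) (hu.1 φ) ρ ≠ 1) :
    ∀ c ∈ weilClassesField A φ P (2 * m), IsRationalClass c → c ≠ 0 → c ∉ divisorClassesSpan A.X A.dim m := by
  intro c hcW _ hc0 hcD
  have h0 : c ∈ weilClassesField A φ P (2 * m) ⊓ divisorClassesSpan A.X A.dim m := ⟨hcW, hcD⟩
  rw [weilClassesField_inf_divisorClassesSpan_eq_bot_of_detOnEigenspace_ne_one hPm hPe hPirr hφ her hm hQ hK hu hρ hdet,
    Submodule.mem_bot] at h0
  exact hc0 h0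

/-- **`[F:ℚ]` independent exceptional classes from one `u ∈ S(A)(ℂ)` with `det(u | V_ρ) ≠ 1`, when `W_F` is Hodge**
(`n_ρ = n_ρ̄` at every root): `e ≤ dim_ℂ Bᵐ ⊗ ℂ − dim_ℂ Dᵐ ⊗ ℂ`. [cite: MoonenZarhin1998WeilClasses, §1 Criterion (2) and
Introduction (W_k of exceptional classes)] [cite: vanGeemen1994HodgeAV, 2.4–2.5 and Thm. 6.12] -/
theorem natDegree_le_finrank_sub_of_detOnEigenspace_ne_one_of_balanced (hPm : P.Monic) (hPe : P.natDegree = e)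
    (hPirr : Irreducible (P.map (Int.castRingHom ℚ)))
    (hφ : Polynomial.eval₂ (Int.castRingHom (CategoryTheory.End A)) (φ : CategoryTheory.End A) P = 0)
    (her : e * (2 * m) = 2 * A.dim) (hm : m ≠ 0) (hQ : IsRationalClass h)
    (hK : ∃ s : ℝ, 0 < s ∧ IsKaehlerClass A.dim A.X ((s : ℂ) • h)) (hu : u ∈ unitaryCentralizerGroup A h)
    {ρ : ℂ} (hρ : Polynomial.eval₂ (Int.castRingHom ℂ) ρ P = 0)
    (hdet : detOnEigenspace u (pullbackOne A φ) (hu.1 φ) ρ ≠ 1)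
    (hbal : ∀ ρ' : ℂ, Polynomial.eval₂ (Int.castRingHom ℂ) ρ' P = 0 →
      eigenMultiplicity A φ ρ' = eigenMultiplicity A φ (starRingEnd ℂ ρ')) :
    e ≤ finrank ℂ ↥(hodgeClassSpan A.dim A.X m) - finrank ℂ ↥(divisorClassesSpan A.X A.dim m) := by
  obtain ⟨ω, hω, hω0, -, -⟩ := exists_generator_pullbackEigenclasses_of_root hPm hPe hPirr hφ her hρ
  have hωW := pullbackEigenclasses_le_weilClassesField (A := A) (φ := φ) (r := 2 * m) hρ hω
  have hωD : ω ∉ divisorClassesSpan A.X A.dim m := by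
    intro hωD
    have h0 : ω ∈ weilClassesField A φ P (2 * m) ⊓ divisorClassesSpan A.X A.dim m := ⟨hωW, hωD⟩
    rw [weilClassesField_inf_divisorClassesSpan_eq_bot_of_detOnEigenspace_ne_one hPm hPe hPirr hφ her hm hQ hK hu hρ
      hdet, Submodule.mem_bot] at h0
    exact hω0 h0
  exact natDegree_le_finrank_hodgeClassSpan_sub_finrank_divisorClassesSpan hPm hPe hPirr hφ her hm hbal hωW hωD

end Exceptional

/-! ### §3 `S(A)(ℂ) ⊂ Sl_F(V)(ℂ)` ⟹ `W_F` Hodge (and decomposable on the `B = D` locus) -/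

section SLF

/-- **«`G_div(X) ⊆ Sl_F(V_X)`, hence `G_div(X)` acts trivially on `W_F`» ⟹ `W_F ⊗ ℂ ≤ Bᵐ ⊗ ℂ`**: for `P` monic
irreducible of degree `e`, `P(φ) = 0`, `e · 2m = 2 dim A` and `h ∈ B¹(A) ⊗ ℂ`: if `det(u | V_ρ) = 1` for every
`u ∈ S(A)(ℂ) = unitaryCentralizerGroup A h` and every complex root `ρ` of `P`, then every `⋀^{2m}u` fixes `W_F ⊗ ℂ`
(Lemma (2), converse: `apply_eq_of_mem_weilClassesField_of_comm_of_detOnEigenspace_eq_one`) and the `S(A)`-invariants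
are Hodge classes (`Milne1999.mem_hodgeClassSpan_of_forall_exteriorPullback_eq`: `Hg ≤ S`, Deligne I 3.4).  (In print
the invariants are even `D^•`, Lemma (3) / Milne Thm. 3.2 — not proved here.) [cite: MoonenZarhin1998WeilClasses, §1
proof of Criterion (2) («Conversely …»; chunk p0003)] [cite: Milne1999LefschetzClasses, §4 p. 660 (L(A) ⊃ Hg(A))]
[cite: Deligne1982HodgeCycles, I §3 Prop. 3.4] -/
theorem weilClassesField_le_hodgeClassSpan_of_forall_unitaryCentralizerGroup_detOnEigenspace_eq_one
    (hPm : P.Monic) (hPe : P.natDegree = e) (hPirr : Irreducible (P.map (Int.castRingHom ℚ)))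
    (hφ : Polynomial.eval₂ (Int.castRingHom (CategoryTheory.End A)) (φ : CategoryTheory.End A) P = 0)
    (her : e * (2 * m) = 2 * A.dim) (hh : h ∈ hodgeClassSpan A.dim A.X 1)
    (hdet : ∀ u (hu : u ∈ unitaryCentralizerGroup A h) (ρ : ℂ), Polynomial.eval₂ (Int.castRingHom ℂ) ρ P = 0 →
      detOnEigenspace u (pullbackOne A φ) (hu.1 φ) ρ = 1) :
    weilClassesField A φ P (2 * m) ≤ hodgeClassSpan A.dim A.X m := by
  intro c hc
  refine mem_hodgeClassSpan_of_forall_exteriorPullback_eq hh fun u hu => ?_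
  exact apply_eq_of_mem_weilClassesField_of_comm_of_detOnEigenspace_eq_one hPm hPe hPirr hφ her
    (exteriorPullback_cupPowOne_abelianVariety u _) (hu.1 φ) (hdet u hu) hc

/-- … hence **`n_ρ = n_ρ̄` at every complex root of `P`** (the Criterion as an `iff`, the tree's
`Deligne1982.weilClassesField_le_hodgeClassSpan_iff_forall_eigenMultiplicity_eq`). [cite: MoonenZarhin1998WeilClasses, §1
Criterion and proof of Criterion (2)] -/
theorem forall_eigenMultiplicity_eq_of_forall_unitaryCentralizerGroup_detOnEigenspace_eq_one (hPm : P.Monic)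
    (hPe : P.natDegree = e) (hPirr : Irreducible (P.map (Int.castRingHom ℚ)))
    (hφ : Polynomial.eval₂ (Int.castRingHom (CategoryTheory.End A)) (φ : CategoryTheory.End A) P = 0)
    (her : e * (2 * m) = 2 * A.dim) (hh : h ∈ hodgeClassSpan A.dim A.X 1)
    (hdet : ∀ u (hu : u ∈ unitaryCentralizerGroup A h) (ρ : ℂ), Polynomial.eval₂ (Int.castRingHom ℂ) ρ P = 0 →
      detOnEigenspace u (pullbackOne A φ) (hu.1 φ) ρ = 1)
    {ρ : ℂ} (hρ : Polynomial.eval₂ (Int.castRingHom ℂ) ρ P = 0) :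
    eigenMultiplicity A φ ρ = eigenMultiplicity A φ (starRingEnd ℂ ρ) :=
  (Deligne1982.weilClassesField_le_hodgeClassSpan_iff_forall_eigenMultiplicity_eq hPm hPe hPirr hφ her).1
    (weilClassesField_le_hodgeClassSpan_of_forall_unitaryCentralizerGroup_detOnEigenspace_eq_one hPm hPe hPirr hφ her
      hh hdet) ρ hρ

/-- **On the `B = D` locus, `S(A)(ℂ) ⊂ Sl_F(V)(ℂ)` ⟹ `W_F` decomposable** (`IsDivisorGenerated A`: `Bᵖ ⊆ Dᵖ ⊗ ℂ` for all
`p`; then §3 lands in `Dᵐ ⊗ ℂ`) — the printed «hence `G_div(X)` acts trivially on `W_F`» ⟹ «all classes in `W_F` are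
decomposable» where the tree has Lemma (3). [cite: MoonenZarhin1998WeilClasses, §1 proof of Criterion (2)]
[cite: Milne1999LefschetzClasses, Thm. 3.2 and Cor. 4.5] -/
theorem weilClassesField_le_divisorClassesSpan_of_forall_detOnEigenspace_eq_one_of_isDivisorGenerated
    (hPm : P.Monic) (hPe : P.natDegree = e) (hPirr : Irreducible (P.map (Int.castRingHom ℚ)))
    (hφ : Polynomial.eval₂ (Int.castRingHom (CategoryTheory.End A)) (φ : CategoryTheory.End A) P = 0)
    (her : e * (2 * m) = 2 * A.dim) (hh : h ∈ hodgeClassSpan A.dim A.X 1) (hBD : IsDivisorGenerated A)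
    (hdet : ∀ u (hu : u ∈ unitaryCentralizerGroup A h) (ρ : ℂ), Polynomial.eval₂ (Int.castRingHom ℂ) ρ P = 0 →
      detOnEigenspace u (pullbackOne A φ) (hu.1 φ) ρ = 1) :
    weilClassesField A φ P (2 * m) ≤ divisorClassesSpan A.X A.dim m := by
  refine le_trans (weilClassesField_le_hodgeClassSpan_of_forall_unitaryCentralizerGroup_detOnEigenspace_eq_one hPm hPe
    hPirr hφ her hh hdet) ?_
  rw [Submodule.span_le]
  rintro c ⟨hcQ, hcH⟩
  exact hBD m c hcQ hcH

end SLF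

end HodgeTheory

end Literature.AlgebraicGeometry.HodgeTheory

end
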